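import Summits.BirchSwinnertonDyer.BirchSwinnertonDyer.Theorems.ClassRecordThreeCornerAtThreeKolyImageOrderEntryEndShift
import Summits.BirchSwinnertonDyer.BirchSwinnertonDyer.Theorems.ErratumRoadFiveShimuraKolyvaginOrderBoundInertS2OfCarrier
import Summits.BirchSwinnertonDyer.BirchSwinnertonDyer.Theorems.ClassRecordThreeCornerAtThreeShimuraCarrierOfNoTorsion
import Literature.NumberTheory.EllipticCurves.CasselsTateLevelInputs
import Literature.NumberTheory.EllipticCurves.WeilPairingProofs
import HarnessLib
/-!
# The IMAGE-KEYED Kolyvagin ORDER machine, INDEX FORM: `#Ш(E/K)[p^∞] ≤ p^(2·ord_p[E(K):ℤP])` for a point `P` of finite index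
# carrying the depth-`k` ring-class-rational Euler system on the INERT locus, from Poitou–Tate, the Cassels–Tate inputs at level
# `p^{M₀}` and the four image inputs instead of `5 ≤ p` ∧ `ρ̄_{E,p}` onto (ANY odd `p`; at `3` on the (T4″)₃ corner)
# (crux `CornerAtThree`, item stmt-BirchSwinnertonDyer-19111, conjunct 3 along the CARRIER-INERT Shimura road;
# cell `bsd-stepL`, seat `bsd-stepL-corner3-p2` g5 = WIDTH-LEVER lane B; `--supports … --as helper`)

HONEST FRAMING: THEOREMS ONLY (no definition, no named fact, no `sorry`); nothing here is a BSD class theorem;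
no census label moves (T7); item 19111 is NOT closed; every statement is CONDITIONAL on its displayed binders
exactly as its `hρ`-keyed original. BSD is not proved by any of this.

## The series (why this file exists)

Lane B's typed object `Theorems.CornerAtThreeShimuraInertDisplay` (conjunct 1 of the registered stub
`stub_upper3_inertDisplay` of `Cruxes/CornerAtThree/Lines/inert.lean`, planner RULING 35) is Kolyvagin's UNSHARP
order bound `#Ш(E/K)[3^∞] ≤ 3^(2·ord₃[E(K):ℤP])` for the CM point of `X_{N⁺,N⁻}` with `3 ∣ N⁻` on the (T4″)₃
corner (`E[3]` irreducible, `ρ̄_{E,3}` NOT onto). The tree's Shimura–Kolyvagin ORDER chain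
(`ErratumRoadFiveShimuraKolyvaginOrderBoundInert*`, `ClassRecordThreeShimuraKolyvaginOrderBoundAtThreeSurjOrderShift*`;
seats shim-p1 ∕ shim3a) is keyed on `hρ : ρ̄_{E,p}` ONTO, read ONLY through four consequences (seat shim3b g4 ∕ g5,
memo `shim/SHIM3B-G5-NOTE-19616.md` §2 «execute only if a consumer appears» — the consumer is lane B's inert line):
(hIz) some `z ∈ Γ_K` acts as `−1` on `E(K̄)[p]`, (hIs) `E(K̄)[p]` is a simple `Γ_K`-module, (hIc) its
`Γ_K`-commutant is scalar, (hIt) `E(K)[p] = 0`. The series `ClassRecordThreeCornerAtThreeKolyImage*.lean`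
(namespace `…Theorems.ShimuraKolyvaginOfImage`; theorem names = originals + `_ofImage`) re-keys the chain on these
four binders: statements and proofs are the originals VERBATIM with `hρ` replaced by `(hIz) (hIs) (hIc) (hIt)` and
the image-reading leaves replaced by shim3b's landed twins (`ShimuraKolyvaginCebotarevOfImage.McCallum1991_cor_3_2_pow_of_image`,
`ShimuraKolyvaginCebotarevKernelOfImage.exists_kolyvaginPrime_gt_pow_kernel_of_image`,
`ShimuraKolyvaginFixedOfTorsion.{geomTorsion_pow_eq_zero_of_fixed, torsionH1OfDvd_pow_injective}_of_torsionBy_eq_bot`,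
`KolyvaginDescent.*_of_torsionBy_eq_bot`). At `p = 3` the four inputs hold for EVERY irreducible `E[3]`
(`ShimuraKolyvaginOfImage.kolyvaginImageInputs_three_of_mem_inertSet`, p563651), so the re-keyed END serves the
corner; at `p ∈ {5, 7}` they hold on the non-surjective corners given `−1 ∈ ρ̄(Γ_ℚ)` (shim3b
`McCallum1991_cor_3_2_pow_of_irr_of_neg`). No new mathematics is claimed in the re-keyed files.

## THIS FILE re-keys shim-p1 g8's `…InertS2OfCarrier` (p496578) FIRST theorem only:
`natCard_sha_primary_le_pow_index_of_ringClassRationalPointsM_shift_of_poitouTate_of_localDuality_ofImage` = `M₀ = 0` from I4e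
(`natCard_primaryComponent_sha_le_of_ringClassRationalPointsM_shift_of_poitouTate_ofImage`) and `M₀ ≥ 1` from I14
(`card_sha_primary_le_of_ringClassRationalPointsM_shift_of_poitouTate_of_localDuality_ofImage`) after McCallum's Lemma 5.1
(`Additive.zsmul_certificate_of_padicValNat_index`, `E(K)[p] = 0` = (hIt)); the binder `5 ≤ p` of the original (there only for
`p ≠ 2`) is `p ≠ 2` here. The displayed-carrier ∕ height-transfer second theorem of the original is not needed (lane B takes
`P :=` the bottom CM point itself) and is not copied.
Statements ∕ proofs VERBATIM the originals except `hρ` ↦ `(hIz) (hIs) (hIc) (hIt)`, the image-reading leaves ↦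
shim3b's `_of_image` ∕ `_of_torsionBy_eq_bot` twins (and I1 `KolyvaginDescent.*_of_torsionBy_eq_bot`), and calls into
earlier `_ofImage` twins of this series.
[cite: McCallumLMS1991, §1 Theorem (Kolyvagin), §3 Prop. 3.1, Cor. 3.2, §4 Lemma 4.3, Prop. 4.4, Lemma 4.6, Prop. 4.7, §5 Lemmas 5.1, 5.3, Thm. 5.4, Cor. 5.6]
[cite: GrossLMS1991, §2 Thm. 2.2 (2), Props. 5.3, 5.4, 8.2, §9, §10] [cite: Howard2004Duke, Thm. 3.2.2 (proof)] [cite: MilneADT2006, Ch. I Thm. 4.10(b), §6 Prop. 6.9, Thm. 6.13(a), Lemma 6.17]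
presearch: as I2 (cell D8 audit; shim3b g5 §1: nothing in print at an inert p = 3 for non-surjective image).

## (second part, merged to shorten the gate chain) the `p`-GENERIC END on the inert Shimura locus for any image delivering the four inputs:

# The IMAGE-KEYED Kolyvagin ORDER machine — `p`-GENERIC END on the inert Shimura locus: Kolyvagin's bound
# `#Ш(E/K)[p^∞] ≤ p^(2·ord_p[E(K):ℤy])` for the bottom CM point of `X_{N⁺,N⁻}` (`p ∈ S` inert), for ANY odd `p` and ANY image
# delivering the four image inputs + ring-class no-torsion, from Poitou–Tate and `casselsTate_levelInputs`
# (crux `CornerAtThree`, item stmt-BirchSwinnertonDyer-19111, conjunct 3 along the CARRIER-INERT Shimura road; by-product for crux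
# 19065 `NonSurjCorner` at `p ∈ {5,7}`; cell `bsd-stepL`, seat `bsd-stepL-corner3-p2` g5 = WIDTH-LEVER lane B; `--supports … --as helper`)

HONEST FRAMING: THEOREMS ONLY (no definition, no named fact, no `sorry`); nothing here is a BSD class theorem; no census label
moves (T7); no item is closed. CONDITIONAL on the displayed binders: `hPT : poitouTate_sum_localTatePairing_eq_zero K` (Milne ADT I
Thm. 4.10(b)), `hCT : casselsTate_levelInputs K` (UNPROVED Literature named fact), the bare CM family with its five printed labels
(Gross 1991 (4.1), Props. 3.7, 5.3; BD96 §2; Nekovář 2007 (4.8)(4.9); Darmon 2004 Prop. 3.11) and guarded index clause (Nekovář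
Thm. 3.2), the four image inputs and `htor`. This is the `p`-generic statement of which the seat's `p = 3` END
(`ClassRecordThreeCornerAtThreeShimuraInertDisplayOfPrimitives.lean`) is the instance with every image-side input discharged from
`Irr W 3`; it is filed so that the `p ≥ 5` non-surjective inert frames (crux 19065, seat corner5-p2; crux 19718's locus minus
`ρ̄` onto) consume the SAME machine by supplying their inputs (`−1 ∈ ρ̄_{E,p}(Γ_ℚ)` is the one genuine image hypothesis there).
BSD is not proved by any of this.
[cite: McCallumLMS1991, §1 Theorem (Kolyvagin), §3 Cor. 3.2, §4 Lemma 4.3, Prop. 4.4, Lemma 4.6, §5 Lemma 5.1, Thm. 5.4, Cor. 5.6]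
[cite: GrossLMS1991, §2, §§3–5, Prop. 6.2 (1), §9, §10] [cite: Howard2004Duke, Lemma 3.1.5, Thm. 3.2.2 (proof)]
[cite: MilneADT2006, Ch. I Thm. 4.10(b)(c), Prop. 6.9, Thm. 6.13(a), Lemma 6.17] [cite: SilvermanAEC2009, Prop. III.8.1, Thm. VII.6.1]
[cite: Kim2022HigherGZ, §2.1 and Thm. 4.3 (printed twin p ≥ 5, ρ̄ onto)]
presearch: as the END file (cell D8 audit; shim3b g5 §1): no printed Kolyvagin order bound at an inert p ∣ N⁻ for non-surjective image.
-/

noncomputable section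

open scoped Classical AddSubgroup
set_option linter.dupNamespace false

universe u

namespace Summit.BirchSwinnertonDyer.BirchSwinnertonDyer.Theorems.ShimuraKolyvaginOfImage

open Summit.BirchSwinnertonDyer.BirchSwinnertonDyer.Theorems.ShimuraKolyvaginLocalShift
open WeierstrassCurve NumberField IsDedekindDomain Field Function
  Literature.NumberTheory.EllipticCurves Literature.NumberTheory.EllipticCurves.KolyvaginCocycle
  Literature.NumberTheory.EllipticCurves.KolyvaginDescent
  Literature.NumberTheory.EllipticCurves.RingClassField
  Literature.NumberTheory.GaloisRepresentations Literature.NumberTheory.GaloisCohomology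
  Literature.NumberTheory.NumberFields Literature.NumberTheory.DiophantineGeometry
  Summit.BirchSwinnertonDyer.Rank1Residual.X11b
  Summit.BirchSwinnertonDyer.BirchSwinnertonDyer.Theorems
  Summit.BirchSwinnertonDyer.BirchSwinnertonDyer.Theorems.ShimuraKolyvaginOrder
open Literature.NumberTheory.GaloisRepresentations.DiscreteGaloisModule (mu MuCarrier)

-- Cup products need `LocallyCompactSpace Γ_K`; as in the tree's Cassels–Tate files.
attribute [local instance] absoluteGaloisGroup_compactSpace

-- `CharZero` of the completions (the Cassels–Tate local terms), as in the tree's files.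
attribute [local instance] charZero_placeCompletion

variable {K : Type} [Field K] [NumberField K]

/-- **Crux 19718's conclusion in INDEX form, `p` odd (image inputs (hIz) (hIs) (hIc) (hIt)): `#Ш(E/K)[p^∞] ≤ p^(2·ord_p[E(K):ℤP])`** for a point `P`
of finite index carrying the depth-`k` ring-class-rational Euler system `hpointsRk` (binder VERBATIM from p482014), from
Poitou–Tate and the Cassels–Tate inputs at level `p^{M₀}`, `M₀ = ord_p[E(K):ℤP]` — the `p`-generic twin of shim3a's
`natCard_sha_three_primary_le_pow_index_of_ringClassRationalPointsM_shift_of_poitouTate_of_localDuality_ofImage` (p489089):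
`M₀ = 0` is shim-p1's `natCard_primaryComponent_sha_le_of_ringClassRationalPointsM_shift_of_poitouTate_ofImage` (p482014),
`M₀ ≥ 1` shim3a's ORDER machine `card_sha_primary_le_of_ringClassRationalPointsM_shift_of_poitouTate_of_localDuality_ofImage`
(`p`-generic) after McCallum's Lemma 5.1 (`Additive.zsmul_certificate_of_padicValNat_index`, `E(K)[p] = 0`).
NO clause on `E`. [cite: McCallumLMS1991, §1 Theorem (Kolyvagin), Lemma 5.1, Cor. 5.6] [cite: GrossLMS1991, §2 Thm. 2.2 (2)]
[cite: MilneADT2006, Ch. I Thm. 4.10(b), §6 Thm. 6.13(a)] -/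
theorem natCard_sha_primary_le_pow_index_of_ringClassRationalPointsM_shift_of_poitouTate_of_localDuality_ofImage
    (hPT : poitouTate_sum_localTatePairing_eq_zero K)
    (W : WeierstrassCurve ℚ) [W.IsElliptic] [W.IsGloballyMinimal] {N : ℕ} [NeZero N]
    (hN : W.conductorNorm ℤ = N) {p : ℕ} [Fact p.Prime] (hp2 : p ≠ 2) (hIz : ∃ z : Field.absoluteGaloisGroup K, ∀ t : geomTorsion (W.baseChange K) p, z • t = -t)
    (hIs : (W.baseChange K).HasIrreducibleModPGaloisRep p)
    (hIc : ∀ f : geomTorsion (W.baseChange K) p →+ geomTorsion (W.baseChange K) p,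
      (∀ (g : Field.absoluteGaloisGroup K) (t : geomTorsion (W.baseChange K) p), f (g • t) = g • f t) →
        ∃ k : ℤ, ∀ t, f t = k • t)
    (hIt : AddSubgroup.torsionBy (W.baseChange K).toAffine.Point (p : ℤ) = ⊥)
    (hK : IsImaginaryQuadratic K)
    (ι : K →+* ℂ) {S : Finset ℕ}
    (hin : ∀ ℓ ∈ S, ℓ.Prime ∧ ℓ ∣ N ∧ ¬ ℓ ^ 2 ∣ N ∧
      ((Ideal.span {(ℓ : ℤ)}).primesOver (𝓞 K)).ncard = 1 ∧ ¬ (ℓ : ℤ) ∣ NumberField.discr K)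
    (hsp : ∀ ℓ : ℕ, ℓ.Prime → ℓ ∣ N → ℓ ∉ S → ((Ideal.span {(ℓ : ℤ)}).primesOver (𝓞 K)).ncard = 2)
    {P : (W.baseChange K).toAffine.Point} (hnt : ¬ IsOfFinAddOrder P)
    (hidx0 : 0 < (AddSubgroup.zmultiples P).index) {M₀ : ℕ}
    (hv : padicValNat p (AddSubgroup.zmultiples P).index = M₀) [NeZero (p ^ M₀)]
    {c : K ≃ₐ[ℚ] K} (hc : c ≠ 1) (hcc : c * c = 1)
    (hpointsRk : ∀ (k : ℕ) {M : ℕ} (_hM : 1 ≤ M)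
      (hdiv : ∀ Q : geomPoints (W.baseChange K), ∃ R, ((p ^ M : ℕ) : ℤ) • R = Q)
      (c : K ≃ₐ[ℚ] K) (_hc : c ≠ 1),
      ∃ (ε : ℤ) (τ : AlgebraicClosure K ≃+* AlgebraicClosure K) (hτ : IsLiftOfAut c τ)
        (A : ℕ → AddSubgroup (geomPoints (W.baseChange K)))
        (hA : ∀ m, KolyvaginCocycle.IsAdmissible (Field.absoluteGaloisGroup K) (A m)
          ((p ^ M : ℕ) : ℤ))
        (emb : ∀ m : ℕ, ringClassField K ι m →ₐ[K] AlgebraicClosure K)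
        (Pt : ℕ → geomPoints (W.baseChange K))
        (hPt : ∀ m, Pt m ∈
          KolyvaginCocycle.invPoints (Field.absoluteGaloisGroup K) (A m) ((p ^ M : ℕ) : ℤ)),
        (ε = 1 ∨ ε = -1) ∧
        IsOfFinAddOrder (Affine.Point.map (W' := W) (c : K →ₐ[ℚ] K) P - ε • P) ∧
        (∀ m, ∀ a ∈ A m, hτ.pointsMap W a ∈ A m) ∧
        Pt 1 = toGeomPoints (W.baseChange K) P ∧
        (∀ m, m ≠ 0 → ∀ a ∈ A m, ∀ Φ : Field.absoluteGaloisGroup K,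
          (∀ x : ringClassField K ι m, Φ • emb m x = emb m x) → Φ • a = a) ∧
        (∀ m, KolyvaginCocycle.IsAdmissible (Field.absoluteGaloisGroup K) (A m)
          ((p ^ (M + k) : ℕ) : ℤ)) ∧
        (∀ m : ℕ, Squarefree m →
          (∀ q ∈ m.primeFactors, IsKolyvaginPrime N W K p q ∧ FrobEqFrobInfty W K (p ^ (M + k)) q) →
          Pt m ∈ KolyvaginCocycle.invPoints (Field.absoluteGaloisGroup K) (A m)
            ((p ^ (M + k) : ℕ) : ℤ) ∧
          (∃ B ∈ A m, hτ.pointsMap W (Pt m) =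
            (ε * (-1) ^ m.primeFactors.card) • Pt m + ((p ^ M : ℕ) : ℤ) • B) ∧
          (∀ ℓ : ℕ, ℓ.Prime → ℓ ∣ m → ∀ v : HeightOneSpectrum (𝓞 K), (ℓ : 𝓞 K) ∈ v.asIdeal →
            ∀ a : ℕ, (((p : ℤ) ^ a) •
                kolyvaginClass (W.baseChange K) _ hdiv (hA m) (Pt m) (hPt m) ∈
                selmerLocalKer (W.baseChange K) (v.adicCompletion K) ((p ^ M : ℕ) : ℤ) ↔
              ((p : ℤ) ^ a) • kolyvaginClass (W.baseChange K) _ hdiv (hA (m / ℓ)) (Pt (m / ℓ))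
                  (hPt (m / ℓ)) ∈
                (W.baseChange K).torsionLocalKer (v.adicCompletion K) ((p ^ M : ℕ) : ℤ)))))
    (e : geomTorsion (W.baseChange K) ((p ^ M₀ * p ^ M₀ : ℕ) : ℤ) →
      geomTorsion (W.baseChange K) ((p ^ M₀ * p ^ M₀ : ℕ) : ℤ) → AlgebraicClosure K)
    (hμ : ∀ S T, e S T ^ (p ^ M₀ * p ^ M₀) = 1)
    (hadd₁ : ∀ S₁ S₂ T, e (S₁ + S₂) T = e S₁ T * e S₂ T)
    (hadd₂ : ∀ S T₁ T₂, e S (T₁ + T₂) = e S T₁ * e S T₂)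
    (hgal : ∀ (σ : absoluteGaloisGroup K) (S T : geomTorsion (W.baseChange K) ((p ^ M₀ * p ^ M₀ : ℕ) : ℤ)),
      σ • e S T = e (σ • S) (σ • T))
    (halt : ∀ T, e T T = 1) (hnondeg : ∀ T, (∀ S, e S T = 1) → T = 0)
    (inv : LocalInvariants K (p ^ M₀ * p ^ M₀)) (hPT' : inv.SumInvLocalizationEqZero)
    (hinv : ∀ v : HeightOneSpectrum (𝓞 K), Injective (inv (Sum.inr v)))
    (hH3 : ∀ x : galoisCohomology (mu K (p ^ M₀ * p ^ M₀)) 3,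
      (∀ v : Place K, galoisCohomology.localization (mu K (p ^ M₀ * p ^ M₀)) v 3 x = 0) → x = 0)
    (hB : Literature.GroupTheory.FiniteAbelian.IsLevelPairing (p ^ M₀)
      (ctLevelPairing (W.baseChange K) (p ^ M₀) e hμ hadd₁ hadd₂ hgal inv halt hPT' hH3
        (localTerm_finite_support (W := W.baseChange K) (m := p ^ M₀) (e := e) (hμ := hμ)
          (hadd₁ := hadd₁) (hadd₂ := hadd₂) (hgal := hgal) halt inv)))
    (hPτ : ∀ z ∈ selmerGroup (W.baseChange K) ((p ^ M₀ * p ^ M₀ : ℕ) : ℤ),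
      ∀ t ∈ selmerGroup (W.baseChange K) ((p ^ M₀ * p ^ M₀ : ℕ) : ℤ),
      ctGeneralFun (W.baseChange K) (p ^ M₀) e hμ hadd₁ hadd₂ hgal inv
          (torsionH1ToH1 (W.baseChange K) _ (conjAct W c _ z))
          (torsionH1ToH1 (W.baseChange K) _ (conjAct W c _ t)) =
        ctGeneralFun (W.baseChange K) (p ^ M₀) e hμ hadd₁ hadd₂ hgal inv
          (torsionH1ToH1 (W.baseChange K) _ z) (torsionH1ToH1 (W.baseChange K) _ t)) :
    Nat.card (AddCommGroup.primaryComponent (W.baseChange K).sha p) ≤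
      p ^ (2 * padicValNat p (AddSubgroup.zmultiples P).index) := by
  haveI : (W.baseChange K).IsElliptic := inferInstanceAs (W.map (algebraMap ℚ K)).IsElliptic
  have hp : p.Prime := Fact.out
  rcases Nat.eq_zero_or_pos M₀ with h0 | hpos
  · subst h0
    exact natCard_primaryComponent_sha_le_of_ringClassRationalPointsM_shift_of_poitouTate_ofImage hPT W hN hp2 hIz hIs hIc hIt hK ι hin
      hsp hnt hidx0 hv hpointsRk
  -- `E(K)[p] = 0`
  have hbot := hIt
  have hAp : ∀ a : (W.baseChange K).toAffine.Point, ((p : ℕ) : ℤ) • a = 0 → a = 0 := fun a ha ↦ by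
    have : a ∈ AddSubgroup.torsionBy (W.baseChange K).toAffine.Point ((p : ℕ) : ℤ) := by
      rw [mem_torsionBy_iff]; exact ha
    rw [hbot] at this
    exact this
  -- McCallum Lemma 5.1: `ord_p [E(K) : ℤP] = M₀ ⟺ p^{M₀} ∥ P`
  obtain ⟨⟨x₀, hx₀⟩, hmax'⟩ :=
    Summit.BirchSwinnertonDyer.Rank1Residual.Additive.zsmul_certificate_of_padicValNat_index hp
      hAp hnt hidx0.ne' hv
  have hx₀' : p ^ M₀ • x₀ = P := by rw [← natCast_zsmul]; exact hx₀
  have hmax : ∀ Q : (W.baseChange K).toAffine.Point, p ^ (M₀ + 1) • Q ≠ P := fun Q hQ ↦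
    hmax' ⟨Q, by rw [natCast_zsmul]; exact hQ⟩
  rw [hv]
  exact (card_sha_primary_le_of_ringClassRationalPointsM_shift_of_poitouTate_of_localDuality_ofImage hPT W hN hp
    hp2 hIz hIs hIc hIt hK ι hin hsp hnt hpos hc hcc hx₀' hmax hpointsRk e hμ hadd₁ hadd₂ hgal halt hnondeg inv hPT'
    hinv hH3 hB hPτ).2.2.1

section PartTwo

open scoped Classical AddSubgroup

open WeierstrassCurve NumberField IsDedekindDomain Field Function Finset Literature.NumberTheory.EllipticCurves
  Literature.NumberTheory.GaloisRepresentations Literature.NumberTheory.GaloisCohomology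
  Literature.NumberTheory.EllipticCurves.KolyvaginCocycle Literature.NumberTheory.EllipticCurves.RingClassField
  Literature.NumberTheory.EllipticCurves.ModularForms Literature.NumberTheory.EllipticCurves.Rank1Residual
  Summit.BirchSwinnertonDyer.Rank1Residual Summit.BirchSwinnertonDyer.Rank1Residual.X11b

-- Cup products need `LocallyCompactSpace Γ_K`; as in the tree's Cassels–Tate files.
attribute [local instance] absoluteGaloisGroup_compactSpace

-- `CharZero` of the completions (the Cassels–Tate local terms), as in the tree's files.
attribute [local instance] charZero_placeCompletion

variable {K : Type} [Field K] [NumberField K] {W : WeierstrassCurve ℚ}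

/-- **Kolyvagin's ORDER bound `#Ш(E/K)[p^∞] ≤ p^(2·ord_p[E(K):ℤy])` on the INERT Shimura locus for ANY odd `p` and ANY
image of `ρ̄_{E,p}` delivering the four IMAGE INPUTS** (hIz) some `z ∈ Γ_K` acts as `−1` on `E(K̄)[p]`, (hIs) `E(K̄)[p]` simple,
(hIc) scalar `Γ_K`-commutant, (hIt) `E(K)[p] = 0` — and the ring-class no-torsion `htor` (`E(K[k'])` has no `p`-power torsion for
`k' ≥ 1` prime to `p`) — for the bottom point `y` of a bare CM family on `X_{N⁺,N⁻}` carrying the printed labels (B2)–(B5) and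
the guarded index clause, from Poitou–Tate and `casselsTate_levelInputs K`. Inert locus binders `hin` ∕ `hsp` VERBATIM (items
19718 ∕ 19111-D); NO surjectivity, NO `p ≥ 5`, NO Tamagawa clause. The `p`-generic form of this seat's `p = 3` core
(`natCard_sha_three_primary_le_of_shimuraLabels_of_irr_of_casselsTate_of_poitouTate`, where the five image-side inputs come from
`Irr W 3` alone); at `p ∈ {5, 7}` on the non-surjective corners (crux 19065 `NonSurjCorner`, seat corner5-p2) the inputs follow
from `E[p]` irreducible + `−1 ∈ ρ̄_{E,p}(Γ_ℚ)` (shim3b `McCallum1991_cor_3_2_pow_of_irr_of_neg`, `torsionBy_pow_eq_bot_of_neg`)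
and x11b3's `NoTorsionIrr.*` (`p ∤ d_K`, `p ∤ k'`). Proof = the image-keyed inert ORDER chain (I4e unit END ∕ INDEX FORM) over
the image-free carrier `hpointsRk_of_shimuraLabels_of_noTorsion`. CONDITIONAL on `hPT`, `hCT`, the labels and the inputs.
[cite: McCallumLMS1991, §1 Theorem (Kolyvagin), Lemma 5.1, Cor. 5.6] [cite: GrossLMS1991, §2, §9, §10]
[cite: Kim2022HigherGZ, Thm. 4.3 (printed twin)] [cite: MilneADT2006, Ch. I Thm. 4.10(b), Thm. 6.13(a)] -/
theorem natCard_sha_primary_le_of_shimuraLabels_of_imageInputs_of_casselsTate_of_poitouTate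
    (hPT : poitouTate_sum_localTatePairing_eq_zero K)
    (hCT : Literature.NumberTheory.EllipticCurves.casselsTate_levelInputs K)
    [W.IsElliptic] [W.IsGloballyMinimal] {N : ℕ} [NeZero N] (hN : W.conductorNorm ℤ = N)
    {p : ℕ} [Fact p.Prime] (hp2 : p ≠ 2)
    (hIz : ∃ z : Field.absoluteGaloisGroup K, ∀ t : geomTorsion (W.baseChange K) p, z • t = -t)
    (hIs : (W.baseChange K).HasIrreducibleModPGaloisRep p)
    (hIc : ∀ f : geomTorsion (W.baseChange K) p →+ geomTorsion (W.baseChange K) p,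
      (∀ (g : Field.absoluteGaloisGroup K) (t : geomTorsion (W.baseChange K) p), f (g • t) = g • f t) →
        ∃ k : ℤ, ∀ t, f t = k • t)
    (hIt : AddSubgroup.torsionBy (W.baseChange K).toAffine.Point (p : ℤ) = ⊥)
    (hK : IsImaginaryQuadratic K) (ι : K →+* ℂ)
    (htor : ∀ k' : ℕ, k' ≠ 0 → ¬ p ∣ k' →
      ∀ (n' : ℕ) (a : (W.baseChange (ringClassField K ι k')).toAffine.Point),
        ((p ^ n' : ℕ) : ℤ) • a = 0 → a = 0)
    (Dt : ModularParametrizationData W N) {S : Finset ℕ}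
    (hin : ∀ ℓ ∈ S, ℓ.Prime ∧ ℓ ∣ N ∧ ¬ ℓ ^ 2 ∣ N ∧
      ((Ideal.span {(ℓ : ℤ)}).primesOver (𝓞 K)).ncard = 1 ∧ ¬ (ℓ : ℤ) ∣ NumberField.discr K)
    (hsp : ∀ ℓ : ℕ, ℓ.Prime → ℓ ∣ N → ℓ ∉ S → ((Ideal.span {(ℓ : ℤ)}).primesOver (𝓞 K)).ncard = 2)
    (ys : (m : ℕ) → (W.baseChange (ringClassField K ι m)).toAffine.Point)
    {y : (W.baseChange K).toAffine.Point} {ε : ℤ} (hε : ε = 1 ∨ ε = -1)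
    (hguard : ¬ IsOfFinAddOrder y → 0 < (AddSubgroup.zmultiples y).index)
    (hB2 : ∀ T : Finset (ringClassField K ι 1 ≃ₐ[ℚ] ringClassField K ι 1),
      (∀ g, g ∈ T ↔ g ∈ ringClassGal ι 1) →
      WeierstrassCurve.Affine.Point.map (W' := W)
          (algebraMap K (ringClassField K ι 1)).toRatAlgHom y =
        ∑ g ∈ T, pointGalHom W (ringClassField K ι 1) g (ys 1))
    (hB3 : ∀ (m : ℕ), m ≠ 0 → ∀ τm : ringClassField K ι m ≃ₐ[ℚ] ringClassField K ι m,
      (∀ x : ringClassField K ι m, ((τm x : ringClassField K ι m) : ℂ) = starRingEnd ℂ x) →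
      ∃ σ' ∈ ringClassGal ι m, IsOfFinAddOrder
        (pointGalHom W (ringClassField K ι m) τm (ys m) -
          ε • pointGalHom W (ringClassField K ι m) σ' (ys m)))
    (hB3K : ∀ c : K ≃ₐ[ℚ] K, c ≠ 1 →
      IsOfFinAddOrder (WeierstrassCurve.Affine.Point.map (W' := W) (c : K →ₐ[ℚ] K) y - ε • y))
    (hB4 : ∀ m : ℕ, Squarefree m →
      (∀ q ∈ m.primeFactors, ¬ q ∣ N ∧ (Ideal.span {(q : 𝓞 K)}).IsPrime) →
      ∀ (ℓ : ℕ) (_ : ℓ ∈ m.primeFactors) (hle : ringClassField K ι (m / ℓ) ≤ ringClassField K ι m)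
        (σ : ringClassField K ι m ≃ₐ[ℚ] ringClassField K ι m),
        Subgroup.zpowers σ = ringClassGalOver ι m (m / ℓ) →
        letI : Algebra K ℂ := ι.toAlgebra
        ∑ i ∈ Finset.range (ℓ + 1), pointGalHom W (ringClassField K ι m) (σ ^ i) (ys m) =
          W.frobeniusTrace ℓ • WeierstrassCurve.Affine.Point.map (W' := W)
            ((RingClassField.inclusion ι hle).restrictScalars ℚ) (ys (m / ℓ)))
    (hB5 : ∀ m : ℕ, Squarefree m →
      (∀ q ∈ m.primeFactors, ¬ q ∣ N ∧ (Ideal.span {(q : 𝓞 K)}).IsPrime) →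
      ∀ (ℓ : ℕ) (_ : ℓ ∈ m.primeFactors) [Fact ℓ.Prime] (hΔ : ¬ (ℓ : ℤ) ∣ minimalDiscriminantInt W)
        (φ₀ : absoluteGaloisGroup (ZMod ℓ)), (∀ x : AlgebraicClosure (ZMod ℓ), φ₀ • x = x ^ ℓ) →
      ∀ (hle : ringClassField K ι (m / ℓ) ≤ ringClassField K ι m)
        (emb : ringClassField K ι m →+* AlgebraicClosure K),
        (∀ x : K, emb (algebraMap K (ringClassField K ι m) x) = algebraMap K (AlgebraicClosure K) x) →
      ∀ (j : (W.baseChange (ringClassField K ι m)).toAffine.Point →+ geomPoints (W.baseChange K)),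
        j = WeierstrassCurve.Affine.Point.map (W' := W) emb.toRatAlgHom →
      ∀ γ : ringClassField K ι m ≃ₐ[ℚ] ringClassField K ι m, γ ∈ ringClassGal ι m →
        letI : Algebra K ℂ := ι.toAlgebra
        geomReduction hΔ ((RatClosure.pointsEquiv (K := K) W).symm
            (j (pointGalHom W (ringClassField K ι m) γ (ys m)))) =
          φ₀ • geomReduction hΔ ((RatClosure.pointsEquiv (K := K) W).symm
            (j (pointGalHom W (ringClassField K ι m) γ
              (WeierstrassCurve.Affine.Point.map (W' := W)
                ((RingClassField.inclusion ι hle).restrictScalars ℚ) (ys (m / ℓ)))))))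
    (hnt : ¬ IsOfFinAddOrder y) :
    Nat.card (AddCommGroup.primaryComponent (W.baseChange K).sha p) ≤
      p ^ (2 * padicValNat p (AddSubgroup.zmultiples y).index) := by
  haveI hEK : (W.baseChange K).IsElliptic := inferInstanceAs (W.map (algebraMap ℚ K)).IsElliptic
  have hp : p.Prime := Fact.out
  -- the depth-`k` ring-class-rational carrier on `y` from the labels (K4e, image-free)
  have hpointsRk := hpointsRk_of_shimuraLabels_of_noTorsion hK ι hN Dt hp hp2 htor ys hε hB2 hB3 hB3K hB4 hB5
  have hidx : 0 < (AddSubgroup.zmultiples y).index := hguard hnt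
  -- the level `M₀ = ord₃ [E(K):ℤy]`
  set M₀ : ℕ := padicValNat p (AddSubgroup.zmultiples y).index with hM₀def
  have hv : padicValNat p (AddSubgroup.zmultiples y).index = M₀ := rfl
  rcases Nat.eq_zero_or_pos M₀ with h0M | hpos
  · -- unit index: the `M₀ = 0` END, no Cassels–Tate input
    rw [h0M] at hv
    exact natCard_primaryComponent_sha_le_of_ringClassRationalPointsM_shift_of_poitouTate_ofImage hPT W hN hp2 hIz hIs
      hIc hIt hK ι hin hsp hnt hidx hv hpointsRk
  -- divisible index: the ORDER form at level `3^{M₀}`, `M₀ ≥ 1`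
  haveI : NeZero (p ^ M₀) := ⟨pow_ne_zero _ hp.ne_zero⟩
  obtain ⟨c, hc1, hcc⟩ := exists_conj_of_isImaginaryQuadratic (K := K) hK
  have h2 : 2 ≤ p ^ M₀ * p ^ M₀ :=
    le_trans (le_trans hp.two_le (Nat.le_self_pow hpos.ne' p)) (Nat.le_mul_of_pos_right _ (NeZero.pos (p ^ M₀)))
  have hq : ((p ^ M₀ * p ^ M₀ : ℕ) : K) ≠ 0 := Nat.cast_ne_zero.mpr (NeZero.ne (p ^ M₀ * p ^ M₀))
  obtain ⟨e, hμ, hadd₁, hadd₂, halt, hnd, hgal⟩ := exists_weilPairing_holds (W.baseChange K) (p ^ M₀ * p ^ M₀) h2 hq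
  obtain ⟨inv, hPT', hH3, hperf, hB, hPτ⟩ := hCT W p M₀ hp hp2 hpos c hc1 hcc e hμ hadd₁ hadd₂ hgal halt hnd
  exact natCard_sha_primary_le_pow_index_of_ringClassRationalPointsM_shift_of_poitouTate_of_localDuality_ofImage hPT W hN
    hp2 hIz hIs hIc hIt hK ι hin hsp hnt hidx hv hc1 hcc hpointsRk e hμ hadd₁ hadd₂ hgal halt hnd inv hPT'
    (fun v ↦ (hperf v).1.injective) hH3 hB hPτ

end PartTwo

end Summit.BirchSwinnertonDyer.BirchSwinnertonDyer.Theorems.ShimuraKolyvaginOfImage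

end
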